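import Summits.BirchSwinnertonDyer.BirchSwinnertonDyer.Theorems.KatoDescentPotSupersingularWildFineSelmerSupersingularUnitAnchor
import Summits.BirchSwinnertonDyer.BirchSwinnertonDyer.Theorems.KatoDescentTamePotSupersingularTameFineSelmerOrdinaryAnchor
import HarnessLib

/-!
# Route `KatoDescentTamePotSupersingular` (rung K8-t′, cell `bsd-potss`): the SUPERSINGULAR UNIT-ANCHOR road
# for the (t′) Conj-A crux `TameFineSelmerCoatesSujatha` (item stmt-BirchSwinnertonDyer-19413) at an odd
# additive potentially-good prime `p` — twin of the K9 file `…WildFineSelmerSupersingularUnitAnchor.lean`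
# (a `--supports … --as helper` file; seat `bsd-potss-k9-c4` g5, courtesy for `bsd-potss-k8t-c4`;
# ROUTE-FREE; nothing booked, BSD is not proved by any of this)

WHY. The congruence-anchor census of seat `bsd-potss-conjA-anchor` (FINDING-19386-19413 §1d) finds, on
the 163 rows of the (t′) crux at `p ≥ 5`, exactly ONE row with a good partner: 280525t1 (`p = 5`,
`e = 6`, non-split Cartan image) ≃ the CM curve 49a (`5` inert: good SUPERSINGULAR, `a₅ = 0`, rank `0`,
«± unit»: `λ^± = μ^± = 0`). Its printed road is Pollack–Rubin / B. D. Kim + Kobayashi, whose only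
kernel gap was the "± ⊇ fine" bridge — landed by this seat (p466275) together with the supersingular
unit criterion `WildFineSelmerSupersingularUnitAnchor.conjA_rat_of_signedUnitData` (p468234; any odd `p`).
This file records the (t′) ROW ROAD at a general odd `p`:

* `missingUpperBoundAt_addv_of_conjA` — Upper at an additive potentially-good `r_an = 0` row with
  `W[p]` irreducible from (A) AT THE ROW (the chain of k8t-c4/k9-c4 g3's
  `TameFineSelmerOrdinaryAnchor.missingUpperBoundAt_addv_of_congruent_of_finite_selmerInfty_pTorsion`,
  keyed to (A) instead of finite `Sel[p]`);
* **`missingUpperBoundAt_addv_of_supersingularUnitAnchor`** — Upper at the row ⟸ {LS18 `hLS`, Kato fine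
  reading `hKatoA`, Kobayashi 1.2 `h12`, Kim 3.15 `hKim`, GZK, modularity} + ONE congruent globally
  minimal anchor `W′` good at `p` with `a_p(W′) = 0`, `rank E′(ℚ) = 0`, `#Ш(E′)[p^∞] = 1`,
  `p ∤ ∏ c_ℓ(E′)`; `…_analytic` (`r_an(E′) = 0`, `p ∤ #Ш(E′)`).

HONEST FRAMING: conditional-results on the displayed named facts (all typed in the tree; no new fact); the
per-row data are hypotheses (census data of record); item 19413 is NOT closed; class-wide the crux is
Coates–Sujatha (A), a named open problem. References: [BDKim2013] Cor. 3.15; [Kobayashi2003] Thm. 1.2;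
[LimSujatha2018] §3 Prop. 3.2; [Kato2004Asterisque] Thm. 14.5 (3), Prop. 14.16 (2); [Miller2011LMS] Def. 1.1.
-/

set_option autoImplicit false
-- sibling precedent (`KatoDescentPotSupersingularAssembly.lean`): the directory name repeats the summit name
set_option linter.dupNamespace false

noncomputable section

open scoped Classical

namespace Summit.BirchSwinnertonDyer.BirchSwinnertonDyer.Theorems.TameFineSelmerSupersingularUnitAnchor

open WeierstrassCurve Literature.NumberTheory.EllipticCurves
  Literature.NumberTheory.EllipticCurves.Rank1Residual
  Literature.NumberTheory.EllipticCurves.Rank1Residual.Typed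
  Literature.NumberTheory.EllipticCurves.Kobayashi2003
  Summit.BirchSwinnertonDyer.Rank1Residual Summit.BirchSwinnertonDyer.Rank1Residual.Additive
  Summit.BirchSwinnertonDyer.Rank1Residual.O6
  Summit.BirchSwinnertonDyer.BirchSwinnertonDyer.Theorems

/-- **Upper at an additive potentially-good `r_an = 0` row with `W[p]` irreducible, `p` odd, from (A)
AT THE ROW**: Kato's A161″ conclusion in the fine-Selmer reading (`hKatoA`, p420034 at the Conj-A binding)
in Miller's currency (the torsion term vanishes on an irreducible row).
[cite: Kato2004Asterisque, Thm. 14.5 (3) (p. 236), Prop. 14.16 (2) (p. 244)] [cite: Miller2011LMS, Def. 1.1] -/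
theorem missingUpperBoundAt_addv_of_conjA
    (hKatoA :
      Kato2004.rankZero_padicValNat_sha_add_padicValNat_tamagawa_le_of_additive_potGood_of_irreducible_of_fineSelmerDual_fg)
    (hGZK : rank_eq_analyticRank_of_analyticRank_le_one) (hmod : hasEntireLFunction_rat)
    (W : WeierstrassCurve ℚ) [W.IsElliptic] [W.IsGloballyMinimal] (p : ℕ) [Fact p.Prime]
    (hr : W.analyticRank = 0) (hp : p ≠ 2) (hA : Addv W p) (hj : 0 ≤ padicValRat p W.j)
    (hirr : W.HasIrreducibleModPGaloisRep p)
    (hAW : ∀ (κ : ZpExtension ℚ p), κ.IsCyclotomic →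
      ∃ (γ : Field.absoluteGaloisGroup ℚ) (D : W.FineSelmerDualData κ γ),
        Module.Finite ℤ_[p] (RestrictScalars ℤ_[p] (IwasawaAlgebra p) D.X)) :
    MissingUpperBoundAt W p := by
  have hL : W.entireLFunction 1 ≠ 0 := (W.analyticRank_eq_zero_iff_holds (hmod W)).mp hr
  obtain ⟨-, hfin⟩ := hGZK W (by rw [hr]; exact zero_le_one)
  obtain ⟨q₀, hq₀, hle⟩ := WildFineSelmerCongruence.x4UpperOfFineMuZero_conjA hKatoA W p hp hA.1 hA.2
    hj hirr (fun κ hκ ↦ hAW κ hκ) hL hfin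
  have ht0 : padicValNat p W.torsionOrder = 0 := padicValNat_torsionOrder_eq_zero_of_irreducible W p hirr
  obtain ⟨q, hq, hle'⟩ := exists_shaAn_le_add_torsion_of_katoCurrency hGZK hmod W p hr hfin hq₀
    (by rw [ht0, Nat.cast_zero, mul_zero, add_zero]; exact hle)
  refine ⟨q, hq, ?_⟩
  rw [ht0, Nat.cast_zero, add_zero] at hle'
  exact hle'

/-- **THE SUPERSINGULAR UNIT-ANCHOR ROAD at an additive potentially-good odd prime, row form (K8-t′
currency).** Let `W/ℚ` be globally minimal with `r_an = 0`, `p ≠ 2` additive potentially good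
(`Addv W p`, `v_p(j) ≥ 0`), `W[p]` irreducible; suppose ONE globally minimal `W′/ℚ` with `W′[p] ≃ W[p]`
(`O6.ModPCongruent W′ W p`), GOOD reduction at `p` with `a_p(W′) = 0` (supersingular), `rank E′(ℚ) = 0`,
`#Ш(E′)[p^∞] = 1`, `p ∤ ∏ c_ℓ(E′)`. Then `ord_p #Ш(E) ≤ ord_p #Ш(E)_an` — below Lim–Sujatha (`hLS`),
Kato's fine reading (`hKatoA`), Kobayashi 1.2 (`h12`), Kim 3.15 (`hKim`), GZK, modularity. (Census:
280525t1 ≃ 49a at `p = 5`.) [cite: BDKim2013, Cor. 3.15 (p. 199)] [cite: Kobayashi2003, Thm. 1.2]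
[cite: LimSujatha2018, §3 Prop. 3.2] [cite: Kato2004Asterisque, Thm. 14.5 (3), Prop. 14.16 (2)] -/
theorem missingUpperBoundAt_addv_of_supersingularUnitAnchor
    (hLS : LimSujatha2018.prop32_fineSelmerDual_moduleFinite_iff_of_torsionIso)
    (hKatoA :
      Kato2004.rankZero_padicValNat_sha_add_padicValNat_tamagawa_le_of_additive_potGood_of_irreducible_of_fineSelmerDual_fg)
    (h12 : Kobayashi2003.thm12_signedSelmerDual_finite_torsion)
    (hKim : BDKim2013.cor315_signedCharValue_rankZero)
    (hGZK : rank_eq_analyticRank_of_analyticRank_le_one) (hmod : hasEntireLFunction_rat)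
    (W : WeierstrassCurve ℚ) [W.IsElliptic] [W.IsGloballyMinimal] (p : ℕ) [Fact p.Prime]
    (hr : W.analyticRank = 0) (hp : p ≠ 2) (hA : Addv W p) (hj : 0 ≤ padicValRat p W.j)
    (hirr : W.HasIrreducibleModPGaloisRep p)
    (W' : WeierstrassCurve ℚ) [W'.IsElliptic] [W'.IsGloballyMinimal] (hcong : ModPCongruent W' W p)
    (hgood' : W'.HasGoodReductionAtPrime p) (hap' : W'.frobeniusTrace p = 0)
    (hrank' : W'.mordellWeilRank = 0) (hsha' : Nat.card (AddCommGroup.primaryComponent W'.sha p) = 1)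
    (htam' : ¬ p ∣ W'.tamagawaProduct) :
    MissingUpperBoundAt W p :=
  missingUpperBoundAt_addv_of_conjA hKatoA hGZK hmod W p hr hp hA hj hirr
    (WildFineSelmerCongruenceFact.conjA_of_modPCongruent hLS hp hcong
      (WildFineSelmerSupersingularUnitAnchor.conjA_rat_of_signedUnitData h12 hKim W' hp hgood' hap' hrank'
        hsha' htam'))

/-- **The same with the anchor's data in PRINTED form**: `r_an(E′) = 0`, `p ∤ #Ш(E′/ℚ)`, `p ∤ ∏ c_ℓ(E′)`.
[cite: BDKim2013, Cor. 3.15 (p. 199)] [cite: Kobayashi2003, Thm. 1.2] [cite: LimSujatha2018, §3 Prop. 3.2] -/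
theorem missingUpperBoundAt_addv_of_supersingularUnitAnchor_analytic
    (hLS : LimSujatha2018.prop32_fineSelmerDual_moduleFinite_iff_of_torsionIso)
    (hKatoA :
      Kato2004.rankZero_padicValNat_sha_add_padicValNat_tamagawa_le_of_additive_potGood_of_irreducible_of_fineSelmerDual_fg)
    (h12 : Kobayashi2003.thm12_signedSelmerDual_finite_torsion)
    (hKim : BDKim2013.cor315_signedCharValue_rankZero)
    (hGZK : rank_eq_analyticRank_of_analyticRank_le_one) (hmod : hasEntireLFunction_rat)
    (W : WeierstrassCurve ℚ) [W.IsElliptic] [W.IsGloballyMinimal] (p : ℕ) [Fact p.Prime]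
    (hr : W.analyticRank = 0) (hp : p ≠ 2) (hA : Addv W p) (hj : 0 ≤ padicValRat p W.j)
    (hirr : W.HasIrreducibleModPGaloisRep p)
    (W' : WeierstrassCurve ℚ) [W'.IsElliptic] [W'.IsGloballyMinimal] (hcong : ModPCongruent W' W p)
    (hgood' : W'.HasGoodReductionAtPrime p) (hap' : W'.frobeniusTrace p = 0)
    (hr' : W'.analyticRank = 0) (hsha' : ¬ p ∣ Nat.card W'.sha) (htam' : ¬ p ∣ W'.tamagawaProduct) :
    MissingUpperBoundAt W p := by
  obtain ⟨hmw, hfin⟩ := hGZK W' (by rw [hr']; exact zero_le_one)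
  haveI : Finite W'.sha := hfin
  have hrank' : W'.mordellWeilRank = 0 := by rw [hmw, hr']
  have h1 : Nat.card (AddCommGroup.primaryComponent W'.sha p) = 1 := by
    rw [card_addPrimaryComponent_eq_pow p, Nat.factorization_eq_zero_of_not_dvd hsha', pow_zero]
  exact missingUpperBoundAt_addv_of_supersingularUnitAnchor hLS hKatoA h12 hKim hGZK hmod W p hr hp hA
    hj hirr W' hcong hgood' hap' hrank' h1 htam'

end Summit.BirchSwinnertonDyer.BirchSwinnertonDyer.Theorems.TameFineSelmerSupersingularUnitAnchor

end
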